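import Summits.ABC.IUTFork.Joshi.ArithmeticoidGaloisAmphoric

/-!
# [J-II½] Prop. 7.4.1 (1) «G_L-amphoric» typed LITERALLY, and Prop. 7.4.1 (2), (3) as separate isomorphisms — DERIVED
# (companion of `Joshi/ArithmeticoidCollation.lean` / `Joshi/ArithmeticoidGaloisAmphoric.lean`; one new claim-`Prop`, the rest proved)

Record + proof file of the abc-iut cell, branch E «type Joshi's construction, test vs S» (rung LADDER-ABC:A2.E; seat abc-iut-E-t38,
gen 2); registry sub-rows J2h:Prop7.4.1(1) and J2h:Prop7.4.1(3) of plan/E/JOSHI-DAG.tsv (J2h:Prop7.4.1(2) is `Prop741`, p430183). No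
frozen import (E-PLAN R14). SOURCE: K. Joshi, *Construction of Arithmetic Teichmüller Spaces II½: Deformations of Number Fields*,
arXiv:2305.10398**v12** (UNREFEREED, «Preliminary version for comments»; bib `Joshi2023ATS2half`); locators «p.N l.M» = line M of page
file `pNNNN.txt` of `HOME/plan/repair/lit/renders/Joshi-arxiv-2305.10398-ATS2half/`. Carriers of `Joshi/ArithmeticoidCohomology.lean`
(places `V`, points `Pt v`, arithmeticoids `y : ∀ v, Pt v`, cohomology factors `H i v y_v`, adelic groups `CohArith H i y = ∏_v H i v y_v`,
Fontaine subgroups `cohArithF H Hf i y`), of `Joshi/ArithmeticoidCollation.lean` (`Prop741`, `CohomologyDatum`, `CohPreservesFontaine`)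
and of `Joshi/ArithmeticoidGaloisAmphoric.lean` (the absolute Galois group `GL y` «of L provided by arith(L)_y», `Prop422`,
`GlobalGaloisIsomorphic`) are in force. **No side is taken** on [IUTchIII] Cor. 3.12, on Joshi's claims, or on Mochizuki's report on
them; typed ≠ proved; print's assertion is a `@[claim "Joshi2023ATS2half" "disputed"] def … : Prop`, never an axiom / instance /
Literature fact; what FOLLOWS is proved.

PRINT (p.48 l.25–42): «Proposition 7.4.1. (1) The galois cohomology groups H^i(arith(L)_{y₁}, ℤ(1)), H^i_f(arith(L)_{y₁}, ℤ(1)),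
H^i(arith(L)_{y₁}, ℚ(1)), H^i_f(arith(L)_{y₁}, ℚ(1)) are G_L-amphoric. (2) In other words: for all integers i ≥ 0 one has isomorphism
of groups H^i(arith(L)_{y₁}, ℤ(1)) ≃ H^i(arith(L)_{y₂}, ℤ(1)), and H^i(arith(L)_{y₁}, ℚ(1)) ≃ H^i(arith(L)_{y₂}, ℚ(1)), (3) and also of
the Fontaine subspaces: H^i_f(arith(L)_{y₁}, ℤ(1)) ≃ H^i_f(arith(L)_{y₂}, ℤ(1)), and H^i_f(arith(L)_{y₁}, ℚ(1)) ≃ H^i_f(arith(L)_{y₂},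
ℚ(1)).» The in-paper gloss of «G_L-amphoric» is §4.2, Prop. 4.2.2 (p.21 l.56–58): «… is G_L-amphoric i.e. the isomorphism class of
[it] is determined by the isomorphism class of G_L».

WHAT IS TYPED / PROVED.
* `Prop741Amphoric GL H Hf` — **(1) literally**: for any two arithmeticoids whose absolute Galois groups `GL y₁`, `GL y₂` are
  isomorphic topological groups, and every `i`, there is a group isomorphism of the adelic cohomology groups carrying the Fontaine
  subgroup at `y₁` exactly onto the one at `y₂` (instantiate `H` with the integral or the rational cohomology — the four groups of
  (1) at once). CLAIM, never asserted.
* `prop741Amphoric_iff_prop741` — Joshi's «(2) In other words»: under the standing input of §7.4 that the absolute Galois groups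
  provided by any two arithmeticoids ARE isomorphic (`GlobalGaloisIsomorphic`, p.48 l.21–24 / §7.2 p.46 l.33–35), (1) ⟺ (2)+(3)
  (`Prop741`). Without that input only (2)+(3) ⟹ (1) (`prop741Amphoric_of_prop741`).
* `prop741Amphoric_of_prop422` / `cohArithF_iso_of_prop422` — (1), and (3) separately, DERIVED along the printed proof
  (p.48 l.43–46: «The isomorphism class of G_L determines … the isomorphism class of each of its factors G_{L_v}, so one reduces
  to the local case … [Joshi, 2021a, Theorem 8.4.1]») from `Prop422` and the [J-I] Thm. 8.4.1 datum `coh` with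
  `CohPreservesFontaine` — WITHOUT `GlobalGaloisIsomorphic` (the amphoric form consumes exactly the given isomorphism
  `GL y₁ ≃ₜ* GL y₂`; compare `prop741_of_prop422`, p431584, which needs it).
* `mulEquivOfMemIff` — elementary: a group isomorphism `e : A ≃* B` with `c ∈ K₁ ↔ e c ∈ K₂` restricts to `K₁ ≃* K₂`. Hence
  **(2) and (3) as print states them**, as separate isomorphisms: `prop741_cohArith` (`H^i(y₁) ≃ H^i(y₂)`), `prop741_cohArithF`
  (`H^i_f(y₁) ≃ H^i_f(y₂)`), and the amphoric forms `prop741Amphoric_cohArith` / `prop741Amphoric_cohArithF`.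
READING FLAG (E-ref, inherited from p431584): the identity indexing of places (two arithmeticoids of the SAME `L`, «each of its
factors G_{L_v}») is the form the proof consumes. Standard axioms only; sorry-free. [claim: Joshi2023ATS2half, status: disputed]
-/

set_option autoImplicit false

noncomputable section

open Set

namespace Summit.ABC.IUTFork.Joshi.ATS2half

universe u

/-! ## 0. Elementary: restricting a group isomorphism along a membership equivalence -/

section Restrict

variable {A B : Type u} [Group A] [Group B]

/-- If `e : A ≃* B` satisfies `c ∈ K₁ ↔ e c ∈ K₂`, then `e` maps `K₁` onto `K₂`. [folklore] -/
theorem map_eq_of_mem_iff (e : A ≃* B) {K₁ : Subgroup A} {K₂ : Subgroup B} (h : ∀ c, c ∈ K₁ ↔ e c ∈ K₂) :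
    K₁.map (e : A →* B) = K₂ := by
  ext x
  constructor
  · rintro ⟨c, hc, rfl⟩
    exact (h c).1 hc
  · intro hx
    refine ⟨e.symm x, (h _).2 ?_, ?_⟩
    · simpa using hx
    · simp

/-- A group isomorphism `e : A ≃* B` with `c ∈ K₁ ↔ e c ∈ K₂` restricts to an isomorphism `K₁ ≃* K₂`. [folklore] -/
def mulEquivOfMemIff (e : A ≃* B) {K₁ : Subgroup A} {K₂ : Subgroup B} (h : ∀ c, c ∈ K₁ ↔ e c ∈ K₂) : K₁ ≃* K₂ :=
  (e.subgroupMap K₁).trans (MulEquiv.subgroupCongr (map_eq_of_mem_iff e h))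

/-- The restricted isomorphism is `e` on underlying elements. [folklore] -/
@[simp] theorem coe_mulEquivOfMemIff (e : A ≃* B) {K₁ : Subgroup A} {K₂ : Subgroup B} (h : ∀ c, c ∈ K₁ ↔ e c ∈ K₂)
    (x : K₁) : (mulEquivOfMemIff e h x : B) = e x := rfl

end Restrict

/-! ## 1. Prop. 7.4.1 (1) «G_L-amphoric», literal; its relation to (2)+(3) (`Prop741`) -/

section Amphoric

variable {V : Type u} {Pt : V → Type u}
variable (GL : (∀ v, Pt v) → Type u) [∀ y, Group (GL y)] [∀ y, TopologicalSpace (GL y)]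
variable (H : ℕ → (v : V) → Pt v → Type u) [∀ i v y, CommGroup (H i v y)]

/-- **Prop. 7.4.1 (1)** (p.48 l.25–29): «The galois cohomology groups H^i(arith(L)_{y₁}, ℤ(1)), H^i_f(arith(L)_{y₁}, ℤ(1)),
H^i(arith(L)_{y₁}, ℚ(1)), H^i_f(arith(L)_{y₁}, ℚ(1)) are G_L-amphoric», with «G_L-amphoric i.e. the isomorphism class of [it] is
determined by the isomorphism class of G_L» (Prop. 4.2.2, p.21 l.56–58) and `GL y` = «the absolute Galois group of L provided by
arith(L)_y» (§7.2 p.46 l.33–35): an isomorphism of topological groups `GL y₁ ≃ GL y₂` yields, for every `i`, a group isomorphism of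
the adelic cohomology groups (Def. 7.2.4) carrying the Fontaine subspace (§7.3) of `y₁` onto that of `y₂` — the cohomology group
and its Fontaine subgroup together, for the carrier `H` (integral or rational instantiation). HYPOTHESIS (claim); DERIVED below from
the inputs the printed proof names. [claim: Joshi2023ATS2half, status: disputed] -/
@[claim "Joshi2023ATS2half" "disputed"]
def Prop741Amphoric (Hf : ∀ i v (y : Pt v), Subgroup (H i v y)) : Prop :=
  ∀ (y₁ y₂ : ∀ v, Pt v), Nonempty (GL y₁ ≃ₜ* GL y₂) → ∀ i : ℕ,
    ∃ e : CohArith H i y₁ ≃* CohArith H i y₂, ∀ c, c ∈ cohArithF H Hf i y₁ ↔ e c ∈ cohArithF H Hf i y₂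

variable {GL H}
variable {Hf : ∀ i v (y : Pt v), Subgroup (H i v y)}

/-- (2)+(3) ⟹ (1): isomorphisms for ALL pairs give them in particular for pairs with isomorphic `G_L`.
[claim: Joshi2023ATS2half, status: disputed] -/
theorem prop741Amphoric_of_prop741 (h : Prop741 H Hf) : Prop741Amphoric GL H Hf :=
  fun y₁ y₂ _ i => h y₁ y₂ i

/-- (1) ⟹ (2)+(3) under the standing input of §7.4 (the absolute Galois groups provided by any two arithmeticoids of `L` are
isomorphic, `GlobalGaloisIsomorphic`). [claim: Joshi2023ATS2half, status: disputed] -/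
theorem prop741_of_prop741Amphoric (hGL : GlobalGaloisIsomorphic GL) (h : Prop741Amphoric GL H Hf) : Prop741 H Hf :=
  fun y₁ y₂ i => h y₁ y₂ (hGL y₁ y₂) i

/-- **Joshi's «(2) In other words»** (p.48 l.30): given `GlobalGaloisIsomorphic`, (1) ⟺ (2)+(3).
[claim: Joshi2023ATS2half, status: disputed] -/
theorem prop741Amphoric_iff_prop741 (hGL : GlobalGaloisIsomorphic GL) : Prop741Amphoric GL H Hf ↔ Prop741 H Hf :=
  ⟨prop741_of_prop741Amphoric hGL, prop741Amphoric_of_prop741⟩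

/-! ## 2. Prop. 7.4.1 (2) and (3) as separate isomorphisms, as print states them -/

/-- **Prop. 7.4.1 (2)** (p.48 l.30–34): «for all integers i ≥ 0 one has isomorphism of groups H^i(arith(L)_{y₁}, ·) ≃
H^i(arith(L)_{y₂}, ·)» — from `Prop741`. [claim: Joshi2023ATS2half, status: disputed] -/
theorem prop741_cohArith (h : Prop741 H Hf) (y₁ y₂ : ∀ v, Pt v) (i : ℕ) : Nonempty (CohArith H i y₁ ≃* CohArith H i y₂) :=
  let ⟨e, _⟩ := h y₁ y₂ i
  ⟨e⟩

/-- **Prop. 7.4.1 (3)** (p.48 l.35–42): «and also of the Fontaine subspaces: H^i_f(arith(L)_{y₁}, ·) ≃ H^i_f(arith(L)_{y₂}, ·)» —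
from `Prop741`, by restricting its isomorphism along the membership equivalence. [claim: Joshi2023ATS2half, status: disputed] -/
theorem prop741_cohArithF (h : Prop741 H Hf) (y₁ y₂ : ∀ v, Pt v) (i : ℕ) :
    Nonempty (cohArithF H Hf i y₁ ≃* cohArithF H Hf i y₂) :=
  let ⟨e, he⟩ := h y₁ y₂ i
  ⟨mulEquivOfMemIff e he⟩

/-- (1) for the cohomology groups alone: isomorphic `G_L` ⟹ isomorphic `H^i(arith(L)_y, ·)`.
[claim: Joshi2023ATS2half, status: disputed] -/
theorem prop741Amphoric_cohArith (h : Prop741Amphoric GL H Hf) {y₁ y₂ : ∀ v, Pt v} (hiso : Nonempty (GL y₁ ≃ₜ* GL y₂))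
    (i : ℕ) : Nonempty (CohArith H i y₁ ≃* CohArith H i y₂) :=
  let ⟨e, _⟩ := h y₁ y₂ hiso i
  ⟨e⟩

/-- (1) for the Fontaine subspaces alone: isomorphic `G_L` ⟹ isomorphic `H^i_f(arith(L)_y, ·)`.
[claim: Joshi2023ATS2half, status: disputed] -/
theorem prop741Amphoric_cohArithF (h : Prop741Amphoric GL H Hf) {y₁ y₂ : ∀ v, Pt v} (hiso : Nonempty (GL y₁ ≃ₜ* GL y₂))
    (i : ℕ) : Nonempty (cohArithF H Hf i y₁ ≃* cohArithF H Hf i y₂) :=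
  let ⟨e, he⟩ := h y₁ y₂ hiso i
  ⟨mulEquivOfMemIff e he⟩

/-! ## 3. Along the printed proof: (1) and (3) from Prop. 4.2.2 and [J-I] Thm. 8.4.1 -/

variable {IsArc : Set V} {G : (v : V) → Pt v → Type u} [∀ v y, Group (G v y)] [∀ v y, TopologicalSpace (G v y)]
variable [∀ i v y, TopologicalSpace (H i v y)]

/-- **Prop. 7.4.1 (1) DERIVED along its printed proof** (p.48 l.43–46): an isomorphism `GL y₁ ≃ₜ* GL y₂` gives, by Prop. 4.2.2
(`Prop422`), isomorphisms of the local Galois groups at every place; each induces ([J-I] Thm. 8.4.1, the datum `coh`) an isomorphism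
of that cohomology factor respecting the Fontaine subspaces (`CohPreservesFontaine`); these assemble into an isomorphism of the
products. No use of `GlobalGaloisIsomorphic`. [claim: Joshi2023ATS2half, status: disputed] -/
theorem prop741Amphoric_of_prop422 (𝔠 : CohomologyDatum H IsArc G) (h422 : Prop422 G GL) (hf : 𝔠.CohPreservesFontaine Hf) :
    Prop741Amphoric GL H Hf := by
  intro y₁ y₂ hiso i
  have α : ∀ v, G v (y₁ v) ≃ₜ* G v (y₂ v) := fun v => Classical.choice ((h422 y₁ y₂ hiso).2 v)
  refine ⟨MulEquiv.piCongrRight fun v => (𝔠.coh i v (y₁ v) (y₂ v) (α v)).toMulEquiv, fun c => ?_⟩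
  rw [mem_cohArithF_iff, mem_cohArithF_iff]
  exact forall_congr' fun v => hf i v (y₁ v) (y₂ v) (α v) (c v)

/-- Hence, from Prop. 4.2.2 and [J-I] Thm. 8.4.1 (2) on the Fontaine subspaces, the separate isomorphism of Prop. 7.4.1 (3) for any
two arithmeticoids with isomorphic absolute Galois groups. [claim: Joshi2023ATS2half, status: disputed] -/
theorem cohArithF_iso_of_prop422 (𝔠 : CohomologyDatum H IsArc G) (h422 : Prop422 G GL) (hf : 𝔠.CohPreservesFontaine Hf)
    {y₁ y₂ : ∀ v, Pt v} (hiso : Nonempty (GL y₁ ≃ₜ* GL y₂)) (i : ℕ) :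
    Nonempty (cohArithF H Hf i y₁ ≃* cohArithF H Hf i y₂) :=
  prop741Amphoric_cohArithF (prop741Amphoric_of_prop422 𝔠 h422 hf) hiso i

end Amphoric

end Summit.ABC.IUTFork.Joshi.ATS2half

end
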